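import Literature.Geometry.Riemannian.PICSphereFacts
import Literature.Geometry.Riemannian.HamiltonPIC
import Literature.Topology.FourManifolds.ConnectedSumSpheres
import Literature.Topology.FourManifolds.ConnectedSumSphereIdentity
import HarnessLib

/-!
# `hamilton_pic_sphere_four`: decomposition along Hamilton's proof and status of the discharge

Companion ("Proofs") file of `Literature/Geometry/Riemannian/PICSphereFacts.lean` for the named
fact `Literature.Geometry.Riemannian.hamilton_pic_sphere_four` — **Hamilton 1997, Corollary 1.2(a)** (Comm. Anal.
Geom. 5 (1997), p. 3: "If `M⁴` is a compact four-manifold with positive isotropic curvature,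
then (a) if `π₁ = {1}`, `M⁴` is diffeomorphic to `S⁴`"): a closed simply connected smooth
4-manifold carrying a Riemannian metric of positive isotropic curvature is diffeomorphic to `S⁴`.

## The printed proof and its two halves

Cor. 1.2(a) is read off from Hamilton's **Main Theorem 1.1** (p. 2): "Let `M⁴` be a compact
four-manifold with no essential incompressible space-form. Then `M⁴` admits a metric of positive
isotropic curvature if and only if `M⁴` is diffeomorphic to the sphere `S⁴`, the projective space
`RP⁴`, the product `S³ × S¹`, the twisted product `S³ ×~ S¹` …, or a connected sum of the
above", proved by Ricci flow with surgery (Hamilton 1997 §§2–5, pp. 3–4 for the outline;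
surgery part completed by Chen–Zhu, J. Differential Geom. 74 (2006), Thm. 1.1: finitely many
surgeries, extinction in finite time, and (arXiv p. 24) "`M⁴` is diffeomorphic to a connected sum
of `Ω̄ⱼ` with a finite number of `S³ × S¹` or `S³ ×~ S¹` … and a finite number of `RP⁴`", the
discarded compact pieces with positive curvature operator being `S⁴` or `RP⁴` by Hamilton 1986,
Thm. 1.1). For simply connected `M` only `S⁴` summands occur — in the proof: by Hamilton 1997,
Thm. C3.1 (§3.4, p. 42) the core `S³/Γ` of every quotient neck is `π₁`-injective, so `Γ = 1` and
all necks are `S³ × B¹`, every surgery replaces an `S³ × B¹` by two `B⁴` caps, the discarded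
pieces are simply connected hence `S⁴`, and reversing the surgeries rebuilds `M` from these `S⁴`'s
by connected sums (Hamilton 1997, pp. 3–4; Chen–Zhu 2006, p. 24); in the statement: `π₁` of a
connected sum of 4-manifolds is the free product of the `π₁`'s (van Kampen), `π₁(RP⁴) = ℤ₂`,
`π₁(S³ × S¹) = π₁(S³ ×~ S¹) = ℤ`, so `π₁(M) = 1` forces all summands to be `S⁴`. Accordingly the
fact splits into

1. **the geometric-analytic half** `Literature.Geometry.Riemannian.hamilton_pic_connectedSum_spheres_four` (NAMED
   FACT, this file): a closed simply connected PIC 4-manifold is a connected sum of finitely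
   many copies of `S⁴` (`Literature.IsConnectedSumOfSpheres 4 M`, the tree's relational connected sums
   `Literature.Topology.FourManifolds.IsConnectedSum` of `Literature/Topology/FourManifolds/ConnectedSum.lean`, iterated) —
   Hamilton's Thm. 1.1 / Chen–Zhu's Thm. 1.1 in the simply connected case; its proof is the
   whole Ricci flow with surgery and stays out of reach (no Ricci flow exists in Mathlib or
   `Literature/` at this pin);
2. **the differential-topological half** `Literature.connectedSum_sphere_sphere 4` (named fact of
   `Literature/Topology/FourManifolds/ConnectedSumSpheres.lean`; Kervaire–Milnor 1963,
   Lemma 2.1: `Sⁿ # Sⁿ ≅ Sⁿ`, instance `n = 4`), from which `ConnectedSumSpheres.lean` PROVES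
   that every connected sum of finitely many `n`-spheres is an `n`-sphere
   (`Literature.Topology.FourManifolds.IsConnectedSumOfSpheres.nonempty_diffeomorph_sphere`). **This half is PROVED** for
   every `n`: `Literature.Topology.FourManifolds.connectedSum_sphere_sphere_holds`
   (`Literature/Topology/FourManifolds/ConnectedSumSphereIdentity.lean`, as a corollary of
   `X # Sⁿ ≅ X`: Palais' disc theorem on the sphere (`PalaisDiscSphere.lean`), the standard model
   of `X` as an open gluing of `X ∖ {pt}` and `Sⁿ ∖ {pt}`, and the uniqueness of open gluings).

`hamilton_pic_sphere_four_of_connectedSum_spheres` (PROVED here) assembles the two halves into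
`hamilton_pic_sphere_four`, and with (2) discharged
`hamilton_pic_sphere_four_iff_hamilton_pic_connectedSum_spheres_four` (PROVED here) shows that the
fact is *equivalent* to its geometric-analytic half (1), Hamilton–Chen–Zhu's theorem proper (Ricci
flow with surgery), which is the entire remaining debt of a discharge
`hamilton_pic_sphere_four_holds`. No `_holds` is claimed.

## The duplicate vending

The tree vends Cor. 1.2(a) twice: `Literature.Geometry.Riemannian.hamilton_pic_sphere_four` (`PICSphereFacts.lean`,
hypothesis of the assembly `Literature.SPC4.pic_assembly`) and `Literature.Geometry.Riemannian.hamilton_chen_tang_zhu`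
(`HamiltonPIC.lean`, cite item of route `SmoothPoincare4/PIC`). The two `Prop`s differ only in
the order of instance binders, so they are one debt:
`hamilton_pic_sphere_four_iff_hamilton_chen_tang_zhu`.

## References

* R. S. Hamilton, *Four-manifolds with positive isotropic curvature*, Comm. Anal. Geom. 5 (1997)
  1–92: Thm. 1.1 (p. 2), Cor. 1.2(a) (p. 3), proof outline pp. 3–4, Thm. C3.1 (§3.4 Thm. 3.1,
  p. 42). [Hamilton1997]
* B.-L. Chen, X.-P. Zhu, *Ricci flow with surgery on four-manifolds with positive isotropic
  curvature*, J. Differential Geom. 74 (2006) 177–264 (arXiv:math/0504478: Thm. 1.1 p. 3,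
  reconstruction p. 24, extinction p. 27). [ChenZhu2006]
* R. S. Hamilton, *Four-manifolds with positive curvature operator*, J. Differential Geom. 24
  (1986) 153–179, Thm. 1.1 (p. 153). [Hamilton1986]
* B.-L. Chen, S.-H. Tang, X.-P. Zhu, J. Differential Geom. 91 (2012) 41–80, §1. [ChenTangZhu2012]
* M. Kervaire, J. Milnor, *Groups of homotopy spheres I*, Ann. of Math. 77 (1963), §2,
  Lemma 2.1. [KervaireMilnor1963]
-/

noncomputable section

open scoped Manifold ContDiff

namespace Literature.Geometry.Riemannian

/-! ### The geometric-analytic half: Hamilton's theorem in connected-sum form -/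

/-- NAMED FACT (**Hamilton 1997, Main Theorem 1.1** (Comm. Anal. Geom. 5, p. 2), simply
connected case, in the connected-sum form in which the Ricci flow with surgery delivers it;
surgery argument completed by **Chen–Zhu 2006, Thm. 1.1** (J. Differential Geom. 74; arXiv
p. 3) with the reconstruction of arXiv p. 24; discarded pieces identified by **Hamilton 1986,
Thm. 1.1**). Thm. 1.1: a compact four-manifold with no essential incompressible space-form
admits a metric of positive isotropic curvature iff it "is diffeomorphic to the sphere `S⁴`, the
projective space `RP⁴`, the product `S³ × S¹`, the twisted product `S³ ×~ S¹` …, or a connected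
sum of the above". **Vended here for simply connected `M`, where only `S⁴` summands occur**: a
closed (Hausdorff, second countable, compact), simply connected, smooth 4-manifold `M` admitting
a Riemannian metric of positive isotropic curvature (`HasPositiveIsotropicCurvature`, the frame
condition `R₁₃₁₃ + R₁₄₁₄ + R₂₃₂₃ + R₂₄₂₄ > 2 R₁₂₃₄` of Hamilton p. 2) is a connected sum of
finitely many copies of `S⁴` — `Literature.IsConnectedSumOfSpheres 4 M`: `M` is diffeomorphic to the
round `S⁴`, or is a connected sum (`Literature.Topology.FourManifolds.IsConnectedSum`, Kervaire–Milnor's gluing) of two smooth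
4-manifolds which are such connected sums. Why only `S⁴` summands when `π₁(M) = 1` (this is how
Cor. 1.2(a) follows from Thm. 1.1, and the space-form hypothesis is void: an incompressible space
form `S³/Γ ⊂ M` has `Γ ↪ π₁(M) = 1`): in the proof, Hamilton's Thm. C3.1 (§3.4, p. 42: for a
quotient neck `S³ × [-L, L]/Γ → M⁴` in a compact PIC manifold, `π₁(S³ × {0}/Γ) → π₁(M⁴)`
injects) gives `Γ = 1`, so every neck is `S³ × B¹`, every surgery cuts an `S³ × B¹` and glues in
two `B⁴` caps (p. 3), the discarded pieces have positive curvature operator hence are `S⁴` or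
`RP⁴` (Hamilton 1986, Thm. 1.1, "[4]" on p. 3), and are simply connected, hence `S⁴`; "We can
then recover the original manifold by starting with some collection of standard spaces and doing
surgeries replacing two `B⁴`'s with an `S³ × B¹`" (p. 4), i.e. by connected sums (self-sums,
which would add `S³ × S¹` or `S³ ×~ S¹` summands, and quotient surgeries, which would add `RP⁴`
summands, do not occur); in the statement, `π₁` of a connected sum of 4-manifolds is the free
product of the fundamental groups, and `π₁(RP⁴) = ℤ₂`, `π₁(S³ × S¹) = π₁(S³ ×~ S¹) = ℤ`.
Proof in print: Ricci flow with surgery (Hamilton 1997 §§2–5; Chen–Zhu 2006 §§2–5); not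
attempted in `Literature/`. Users take `(h : hamilton_pic_connectedSum_spheres_four)`.
[cite: Hamilton1997, Thm. 1.1 (p. 2) with pp. 3–4 and Thm. C3.1 (p. 42); Cor. 1.2(a) (p. 3)] [cite: ChenZhu2006, Thm. 1.1 (arXiv p. 3) and the reconstruction, arXiv p. 24] [cite: Hamilton1986, Thm. 1.1 (p. 153)] -/
def hamilton_pic_connectedSum_spheres_four : Prop :=
  ∀ (M : Type) [TopologicalSpace M] [T2Space M] [SecondCountableTopology M]
    [ChartedSpace (EuclideanSpace ℝ (Fin 4)) M] [IsManifold (𝓡 4) ∞ M] [CompactSpace M]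
    [SimplyConnectedSpace M],
    (∃ g : Literature.Geometry.Lorentzian.PseudoRiemannianMetric (𝓡 4) ∞ (EuclideanSpace ℝ (Fin 4))
        (TangentSpace (𝓡 4) : M → Type _), g.IsRiemannian ∧ g.HasPositiveIsotropicCurvature) →
      Literature.Topology.FourManifolds.IsConnectedSumOfSpheres 4 M

/-! ### Assembly: Thm. 1.1 (connected-sum form) + `Sⁿ # Sⁿ ≅ Sⁿ` ⇒ Cor. 1.2(a) -/

/-- **Hamilton 1997, Cor. 1.2(a) from Thm. 1.1.** The named fact `hamilton_pic_sphere_four`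
follows from its two halves: Hamilton's theorem in connected-sum form
(`hamilton_pic_connectedSum_spheres_four`: a closed simply connected PIC 4-manifold is a
connected sum of finitely many `S⁴`'s) and Kervaire–Milnor's `S⁴ # S⁴ ≅ S⁴`
(`Literature.connectedSum_sphere_sphere 4`), via the proved induction
`Literature.Topology.FourManifolds.IsConnectedSumOfSpheres.nonempty_diffeomorph_sphere`. This is the derivation of Cor. 1.2(a)
(p. 3) from Thm. 1.1 (p. 2) in Hamilton's paper. [cite: Hamilton1997, Cor. 1.2(a) (p. 3) of Thm. 1.1 (p. 2)] -/
theorem hamilton_pic_sphere_four_of_connectedSum_spheres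
    (h₁ : hamilton_pic_connectedSum_spheres_four) (h₂ : Literature.Topology.FourManifolds.connectedSum_sphere_sphere.{0, 0, 0} 4) :
    hamilton_pic_sphere_four := by
  intro M _ _ _ _ _ _ _ hg
  exact (h₁ M hg).nonempty_diffeomorph_sphere (by norm_num) h₂

/-- The same assembly for the duplicate vending `Literature.Geometry.Riemannian.hamilton_chen_tang_zhu`
(`HamiltonPIC.lean`). [cite: Hamilton1997, Cor. 1.2(a) (p. 3) of Thm. 1.1 (p. 2)] -/
theorem hamilton_chen_tang_zhu_of_connectedSum_spheres
    (h₁ : hamilton_pic_connectedSum_spheres_four) (h₂ : Literature.Topology.FourManifolds.connectedSum_sphere_sphere.{0, 0, 0} 4) :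
    Literature.Geometry.Riemannian.hamilton_chen_tang_zhu := by
  intro M _ _ _ _ _ _ _ hg
  exact (h₁ M hg).nonempty_diffeomorph_sphere (by norm_num) h₂

/-- Conversely, Cor. 1.2(a) trivially gives the connected-sum form (a manifold diffeomorphic to
`S⁴` is a connected sum of one sphere), so the geometric-analytic half carries exactly the
content of the fact modulo `S⁴ # S⁴ ≅ S⁴`. [cite: Hamilton1997, Cor. 1.2(a) (p. 3)] -/
theorem hamilton_pic_connectedSum_spheres_four_of_hamilton_pic_sphere_four
    (h : hamilton_pic_sphere_four) : hamilton_pic_connectedSum_spheres_four := by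
  intro M _ _ _ _ _ _ _ hg
  obtain ⟨e⟩ := h M hg
  exact .sphere e

/-- **Cor. 1.2(a) from Thm. 1.1, with `S⁴ # S⁴ ≅ S⁴` discharged.** Hamilton's theorem in
connected-sum form (`hamilton_pic_connectedSum_spheres_four`, the Ricci-flow half) alone implies
the named fact `hamilton_pic_sphere_four`: the differential-topological half
`Literature.connectedSum_sphere_sphere 4` is proved (`Literature.Topology.FourManifolds.connectedSum_sphere_sphere_holds`,
`ConnectedSumSphereIdentity.lean`). [cite: Hamilton1997, Cor. 1.2(a) (p. 3) of Thm. 1.1 (p. 2)] -/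
theorem hamilton_pic_sphere_four_of_hamilton_pic_connectedSum_spheres_four
    (h : hamilton_pic_connectedSum_spheres_four) : hamilton_pic_sphere_four :=
  hamilton_pic_sphere_four_of_connectedSum_spheres h (Literature.Topology.FourManifolds.connectedSum_sphere_sphere_holds 4)

/-- **The remaining debt, exactly.** The named fact `hamilton_pic_sphere_four` (Hamilton 1997,
Cor. 1.2(a)) is equivalent to Hamilton's Thm. 1.1 in the simply connected, connected-sum form
`hamilton_pic_connectedSum_spheres_four` (a closed simply connected PIC 4-manifold is a
connected sum of finitely many `S⁴`'s): `Sⁿ # Sⁿ ≅ Sⁿ` being proved, a discharge of the fact is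
*precisely* a formal proof of the Ricci flow with surgery theorem.
[cite: Hamilton1997, Thm. 1.1 (p. 2) and Cor. 1.2(a) (p. 3)] -/
theorem hamilton_pic_sphere_four_iff_hamilton_pic_connectedSum_spheres_four :
    hamilton_pic_sphere_four ↔ hamilton_pic_connectedSum_spheres_four :=
  ⟨hamilton_pic_connectedSum_spheres_four_of_hamilton_pic_sphere_four,
    hamilton_pic_sphere_four_of_hamilton_pic_connectedSum_spheres_four⟩

/-- The same for the duplicate vending `Literature.Geometry.Riemannian.hamilton_chen_tang_zhu`
(`HamiltonPIC.lean`). [cite: Hamilton1997, Cor. 1.2(a) (p. 3) of Thm. 1.1 (p. 2)] -/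
theorem hamilton_chen_tang_zhu_of_hamilton_pic_connectedSum_spheres_four
    (h : hamilton_pic_connectedSum_spheres_four) : Literature.Geometry.Riemannian.hamilton_chen_tang_zhu :=
  hamilton_chen_tang_zhu_of_connectedSum_spheres h (Literature.Topology.FourManifolds.connectedSum_sphere_sphere_holds 4)

/-! ### The duplicate vending -/

/-- `hamilton_chen_tang_zhu` (`HamiltonPIC.lean`) implies `hamilton_pic_sphere_four`
(`PICSphereFacts.lean`): the two vendings of Hamilton 1997, Cor. 1.2(a) differ only in the order
of their instance binders. [cite: Hamilton1997, Cor. 1.2(a) (p. 3)] -/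
theorem hamilton_pic_sphere_four_of_hamilton_chen_tang_zhu
    (h : Literature.Geometry.Riemannian.hamilton_chen_tang_zhu) : hamilton_pic_sphere_four := by
  intro M _ _ _ _ _ _ _ hg
  exact h M hg

/-- `hamilton_pic_sphere_four` (`PICSphereFacts.lean`) implies `hamilton_chen_tang_zhu`
(`HamiltonPIC.lean`). [cite: Hamilton1997, Cor. 1.2(a) (p. 3)] -/
theorem hamilton_chen_tang_zhu_of_hamilton_pic_sphere_four
    (h : hamilton_pic_sphere_four) : Literature.Geometry.Riemannian.hamilton_chen_tang_zhu := by
  intro M _ _ _ _ _ _ _ hg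
  exact h M hg

/-- The two named facts vending Hamilton 1997, Cor. 1.2(a) — `Literature.Geometry.Riemannian.hamilton_pic_sphere_four`
and `Literature.Geometry.Riemannian.hamilton_chen_tang_zhu` — are equivalent (same statement up to the order of
their instance binders), hence a single debt: a discharge of either one discharges both.
[cite: Hamilton1997, Cor. 1.2(a) (p. 3)] -/
theorem hamilton_pic_sphere_four_iff_hamilton_chen_tang_zhu :
    hamilton_pic_sphere_four ↔ Literature.Geometry.Riemannian.hamilton_chen_tang_zhu :=
  ⟨hamilton_chen_tang_zhu_of_hamilton_pic_sphere_four,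
    hamilton_pic_sphere_four_of_hamilton_chen_tang_zhu⟩

end Literature.Geometry.Riemannian

end
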